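import Summits.RiemannHypothesis.RiemannHypothesis.Theorems.TiltedLandingLaw421R3RateLightIsolatedChild

/-! # RATE helper — K-2a «56R»: the located Newton disc ⇒ imaginary/real WINDOWS and the ENERGY-DROP algebra of one moving child and of a pair
(frame-free, constants explicit). TOUCH class, rung R1uᵀ of ⟨33346⟩ `TiltedLandingLaw421R`, route EarlyAppointments; W-08 C4 desk rh-idea-6 g39 — the
re-cut of image 56 (g38, 38015dd8) ordered by the director (CA681)(C): the twin `im_newton_center` is DELETED and the tree lemma
`RhW08.LightIsolatedChild.im_newtonPoint` (token 30) is cited BY NAME; nothing else of image 56 is in the tree. Target `…R3NewtonDiscDrop` (RSV-39).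
From the LOCATED door's conclusion `‖u − (v − K⁻¹)‖ < δ` (`δ = ρ₀/‖K‖`; K-1 `RhW08.PerturbativeRung.SecondOrderNewtonDoorQ`, closed by name in token 28):
(1) the IMAGINARY WINDOW `|Im u − (Im v + Im K/‖K‖²)| < δ` (`im_window_of_newton_disc`, closed-disc and real-part companions);
(2) the ENERGY-DROP ALGEBRA `Im v² − Im u² = −2·Im v·κ − (2·Im v·e + (κ + e)²)`, `κ = Im K/‖K‖²`, `e = Im u − Im v − κ`, `|e| ≤ δ` ⇒
`Im v² − Im u² ≥ −2·Im v·κ − (2|Im v|·δ + (|κ| + δ)²)` (`energy_drop_of_newton_disc`) and `|(Im v² − Im u²) − (−2·Im v·κ − κ²)| ≤ 2(|Im v| + |κ|)·δ + δ²`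
(`energy_drop_two_sided`); (3) the PAIR SUM (`energy_drop_pair`, `drop_scaled_of_pair` — the shape of `PerturbativeDropQ`'s conclusion once
`childEnergy = Im u₁² + Im u₂²`); (4) the DOOR COMPOSE `located_child_of_door` (door hypothesis = `SecondOrderNewtonDoorQ`'s body verbatim).
NOT here: the sign `Im K_w = −1/(2 Im w) + pulls` (tree `RhW08.UncoveredSign` / `RhW08.IsolationSign`) and the `λ`-bookkeeping of the main term
(`RhW08.LeadingDissipation`). No law is typed or weakened; RUNG-P is a candidate, not a theorem. -/

namespace RhW08.NewtonDiscDrop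

open RhW08.LightIsolatedChild (im_newtonPoint)

/-- **(1) the imaginary window of the located Newton disc.** -/
theorem im_window_of_newton_disc {u v K : ℂ} {δ : ℝ} (h : ‖u - (v - K⁻¹)‖ < δ) :
    |u.im - (v.im + K.im / ‖K‖ ^ 2)| < δ := by
  have h1 : |(u - (v - K⁻¹)).im| ≤ ‖u - (v - K⁻¹)‖ := Complex.abs_im_le_norm _
  have h2 : (u - (v - K⁻¹)).im = u.im - (v.im + K.im / ‖K‖ ^ 2) := by
    rw [Complex.sub_im, im_newtonPoint]
  rw [← h2]
  exact lt_of_le_of_lt h1 h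

/-- the non-strict window (closed disc). -/
theorem im_window_of_newton_closedDisc {u v K : ℂ} {δ : ℝ} (h : ‖u - (v - K⁻¹)‖ ≤ δ) :
    |u.im - (v.im + K.im / ‖K‖ ^ 2)| ≤ δ := by
  have h1 : |(u - (v - K⁻¹)).im| ≤ ‖u - (v - K⁻¹)‖ := Complex.abs_im_le_norm _
  have h2 : (u - (v - K⁻¹)).im = u.im - (v.im + K.im / ‖K‖ ^ 2) := by
    rw [Complex.sub_im, im_newtonPoint]
  rw [← h2]
  exact le_trans h1 h

/-- the real window: `|Re u − (Re v − Re K/‖K‖²)| < δ` (`Re (v − K⁻¹) = Re v − Re K/‖K‖²`). -/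
theorem re_window_of_newton_disc {u v K : ℂ} {δ : ℝ} (h : ‖u - (v - K⁻¹)‖ < δ) :
    |u.re - (v.re - K.re / ‖K‖ ^ 2)| < δ := by
  have h1 : |(u - (v - K⁻¹)).re| ≤ ‖u - (v - K⁻¹)‖ := Complex.abs_re_le_norm _
  have h2 : (u - (v - K⁻¹)).re = u.re - (v.re - K.re / ‖K‖ ^ 2) := by
    rw [Complex.sub_re, Complex.sub_re, Complex.inv_re, Complex.normSq_eq_norm_sq]
  rw [← h2]
  exact lt_of_le_of_lt h1 h

/-- **(2a) the energy-drop identity** (pure algebra): with `Im u = Im v + κ + e`,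
`Im v² − Im u² = −2·Im v·κ − (2·Im v·e + (κ + e)²)`. -/
theorem sq_drop_identity (iv iu κ e : ℝ) (h : iu = iv + κ + e) :
    iv ^ 2 - iu ^ 2 = -2 * iv * κ - (2 * iv * e + (κ + e) ^ 2) := by
  rw [h]; ring

/-- **(2b) the error bound** (real form): `|e| ≤ δ` ⇒ `Im v² − Im u² ≥ −2·Im v·κ − (2|Im v|·δ + (|κ| + δ)²)`. -/
theorem sq_drop_ge (iv iu κ e δ : ℝ) (h : iu = iv + κ + e) (he : |e| ≤ δ) :
    -2 * iv * κ - (2 * |iv| * δ + (|κ| + δ) ^ 2) ≤ iv ^ 2 - iu ^ 2 := by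
  rw [sq_drop_identity iv iu κ e h]
  have hδ : 0 ≤ δ := le_trans (abs_nonneg e) he
  have h1 : 2 * iv * e ≤ 2 * |iv| * δ := by
    have h2 : iv * e ≤ |iv| * |e| := by
      rw [← abs_mul]; exact le_abs_self _
    have h3 : |iv| * |e| ≤ |iv| * δ := mul_le_mul_of_nonneg_left he (abs_nonneg iv)
    linarith
  have h4 : (κ + e) ^ 2 ≤ (|κ| + δ) ^ 2 := by
    have h5 : |κ + e| ≤ |κ| + δ := le_trans (abs_add_le κ e) (by linarith)
    have h6 : (κ + e) ^ 2 = |κ + e| ^ 2 := (sq_abs _).symm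
    rw [h6]
    exact pow_le_pow_left₀ (abs_nonneg _) h5 2
  linarith

/-- **(2c) the two-sided error bound** (real form): `|e| ≤ δ` ⇒ `|(Im v² − Im u²) − (−2·Im v·κ − κ²)| ≤ 2(|Im v| + |κ|)·δ + δ²`. -/
theorem sq_drop_two_sided (iv iu κ e δ : ℝ) (h : iu = iv + κ + e) (he : |e| ≤ δ) :
    |(iv ^ 2 - iu ^ 2) - (-2 * iv * κ - κ ^ 2)| ≤ 2 * (|iv| + |κ|) * δ + δ ^ 2 := by
  have hid : (iv ^ 2 - iu ^ 2) - (-2 * iv * κ - κ ^ 2) = -(2 * (iv + κ) * e + e ^ 2) := by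
    rw [h]; ring
  rw [hid, abs_neg]
  have hδ : 0 ≤ δ := le_trans (abs_nonneg e) he
  have h1 : |2 * (iv + κ) * e| ≤ 2 * (|iv| + |κ|) * δ := by
    rw [abs_mul, abs_mul, abs_two]
    have h2 : |iv + κ| ≤ |iv| + |κ| := abs_add_le iv κ
    have h3 : 0 ≤ |iv + κ| := abs_nonneg _
    calc 2 * |iv + κ| * |e| ≤ 2 * (|iv| + |κ|) * |e| := by
          exact mul_le_mul_of_nonneg_right (by linarith) (abs_nonneg e)
      _ ≤ 2 * (|iv| + |κ|) * δ := by
          exact mul_le_mul_of_nonneg_left he (by positivity)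
  have h4 : |e ^ 2| ≤ δ ^ 2 := by
    rw [abs_pow]
    exact pow_le_pow_left₀ (abs_nonneg _) he 2
  calc |2 * (iv + κ) * e + e ^ 2| ≤ |2 * (iv + κ) * e| + |e ^ 2| := abs_add_le _ _
    _ ≤ 2 * (|iv| + |κ|) * δ + δ ^ 2 := by linarith

/-- **(2) ENERGY DROP OF ONE MOVING CHILD in the located Newton disc** (complex form, constants explicit):
`‖u − (v − K⁻¹)‖ < δ` ⇒ `Im v² − Im u² ≥ −2·Im v·(Im K/‖K‖²) − (2|Im v|·δ + (|Im K|/‖K‖² + δ)²)`. -/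
theorem energy_drop_of_newton_disc {u v K : ℂ} {δ : ℝ} (h : ‖u - (v - K⁻¹)‖ < δ) :
    -2 * v.im * (K.im / ‖K‖ ^ 2) - (2 * |v.im| * δ + (|K.im| / ‖K‖ ^ 2 + δ) ^ 2) ≤ v.im ^ 2 - u.im ^ 2 := by
  have hw := im_window_of_newton_disc h
  have habs : |K.im / ‖K‖ ^ 2| = |K.im| / ‖K‖ ^ 2 := by
    rw [abs_div, abs_of_nonneg (by positivity : (0 : ℝ) ≤ ‖K‖ ^ 2)]
  have := sq_drop_ge v.im u.im (K.im / ‖K‖ ^ 2) (u.im - v.im - K.im / ‖K‖ ^ 2) δ (by ring)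
    (by have e : u.im - v.im - K.im / ‖K‖ ^ 2 = u.im - (v.im + K.im / ‖K‖ ^ 2) := by ring
        rw [e]; exact hw.le)
  rw [habs] at this
  exact this

/-- **(2′) the two-sided complex form**: `|(Im v² − Im u²) − (−2·Im v·κ − κ²)| ≤ 2(|Im v| + |κ|)·δ + δ²`, `κ = Im K/‖K‖²`. -/
theorem energy_drop_two_sided {u v K : ℂ} {δ : ℝ} (h : ‖u - (v - K⁻¹)‖ < δ) :
    |(v.im ^ 2 - u.im ^ 2) - (-2 * v.im * (K.im / ‖K‖ ^ 2) - (K.im / ‖K‖ ^ 2) ^ 2)| ≤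
      2 * (|v.im| + |K.im| / ‖K‖ ^ 2) * δ + δ ^ 2 := by
  have hw := im_window_of_newton_disc h
  have habs : |K.im / ‖K‖ ^ 2| = |K.im| / ‖K‖ ^ 2 := by
    rw [abs_div, abs_of_nonneg (by positivity : (0 : ℝ) ≤ ‖K‖ ^ 2)]
  have := sq_drop_two_sided v.im u.im (K.im / ‖K‖ ^ 2) (u.im - v.im - K.im / ‖K‖ ^ 2) δ (by ring)
    (by have e : u.im - v.im - K.im / ‖K‖ ^ 2 = u.im - (v.im + K.im / ‖K‖ ^ 2) := by ring
        rw [e]; exact hw.le)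
  rw [habs] at this
  exact this

/-- **(3) THE PAIR SUM**: two located children `u₁` (of `v`, constant `K₁`, radius `δ₁`) and `u₂` (of `z`, `K₂`, `δ₂`) —
`(Im v² + Im z²) − (Im u₁² + Im u₂²) ≥ −2·Im v·κ₁ − 2·Im z·κ₂ − err₁ − err₂`. -/
theorem energy_drop_pair {u₁ u₂ v z K₁ K₂ : ℂ} {δ₁ δ₂ : ℝ} (h₁ : ‖u₁ - (v - K₁⁻¹)‖ < δ₁) (h₂ : ‖u₂ - (z - K₂⁻¹)‖ < δ₂) :
    (-2 * v.im * (K₁.im / ‖K₁‖ ^ 2) - (2 * |v.im| * δ₁ + (|K₁.im| / ‖K₁‖ ^ 2 + δ₁) ^ 2)) +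
      (-2 * z.im * (K₂.im / ‖K₂‖ ^ 2) - (2 * |z.im| * δ₂ + (|K₂.im| / ‖K₂‖ ^ 2 + δ₂) ^ 2)) ≤
      (v.im ^ 2 + z.im ^ 2) - (u₁.im ^ 2 + u₂.im ^ 2) := by
  have e₁ := energy_drop_of_newton_disc h₁
  have e₂ := energy_drop_of_newton_disc h₂
  linarith

/-- **(3′) the pair sum, main term isolated**: if the two main terms dominate, `X·s² ≥ c` follows by monotonicity — the shape of `PerturbativeDropQ`
(`s = stateKappa`, `c = 3 − C/λ`): for `0 ≤ s²` and `c ≤ (main − err)·s²`, `c ≤ ((Im v² + Im z²) − (Im u₁² + Im u₂²))·s²`. -/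
theorem drop_scaled_of_pair {u₁ u₂ v z K₁ K₂ : ℂ} {δ₁ δ₂ s c : ℝ} (h₁ : ‖u₁ - (v - K₁⁻¹)‖ < δ₁) (h₂ : ‖u₂ - (z - K₂⁻¹)‖ < δ₂)
    (hc : c ≤ ((-2 * v.im * (K₁.im / ‖K₁‖ ^ 2) - (2 * |v.im| * δ₁ + (|K₁.im| / ‖K₁‖ ^ 2 + δ₁) ^ 2)) +
      (-2 * z.im * (K₂.im / ‖K₂‖ ^ 2) - (2 * |z.im| * δ₂ + (|K₂.im| / ‖K₂‖ ^ 2 + δ₂) ^ 2))) * s ^ 2) :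
    c ≤ ((v.im ^ 2 + z.im ^ 2) - (u₁.im ^ 2 + u₂.im ^ 2)) * s ^ 2 := by
  have hp := energy_drop_pair h₁ h₂
  have hs : 0 ≤ s ^ 2 := sq_nonneg s
  exact le_trans hc (mul_le_mul_of_nonneg_right hp hs)

/-- **(4) THE DOOR COMPOSE** — the hypothesis `door` is the body of lens-2's `RhW08.PerturbativeRung.SecondOrderNewtonDoorQ` VERBATIM (K-1, closed by name),
so `located_child_of_door secondOrderNewtonDoorQ_holds …` needs no unfolding: the located moving child comes with its imaginary window and its energy drop
(`δ = ρ₀/‖K‖`). -/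
theorem located_child_of_door
    (door : ∀ (F h : ℂ → ℂ) (v K : ℂ) (ρ₀ Λ : ℝ), Differentiable ℂ F → Differentiable ℂ h → (∀ u : ℂ, F u = (u - v) * h u) → K ≠ 0 → 0 < ρ₀ →
      (1 + ρ₀) * Λ < ρ₀ * ‖K‖ →
      (∀ u : ℂ, ‖u - (v - K⁻¹)‖ ≤ ρ₀ / ‖K‖ → h u ≠ 0) →
      (∀ u : ℂ, ‖u - (v - K⁻¹)‖ = ρ₀ / ‖K‖ → ‖deriv h u / h u - K‖ ≤ Λ) →
      ∃ u : ℂ, ‖u - (v - K⁻¹)‖ < ρ₀ / ‖K‖ ∧ deriv F u = 0 ∧ h u ≠ 0)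
    (F h : ℂ → ℂ) (v K : ℂ) (ρ₀ Λ : ℝ) (hF : Differentiable ℂ F) (hh : Differentiable ℂ h) (hfac : ∀ u : ℂ, F u = (u - v) * h u)
    (hK : K ≠ 0) (hρ : 0 < ρ₀) (hΛ : (1 + ρ₀) * Λ < ρ₀ * ‖K‖)
    (hzf : ∀ u : ℂ, ‖u - (v - K⁻¹)‖ ≤ ρ₀ / ‖K‖ → h u ≠ 0)
    (hlip : ∀ u : ℂ, ‖u - (v - K⁻¹)‖ = ρ₀ / ‖K‖ → ‖deriv h u / h u - K‖ ≤ Λ) :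
    ∃ u : ℂ, deriv F u = 0 ∧ h u ≠ 0 ∧ ‖u - (v - K⁻¹)‖ < ρ₀ / ‖K‖ ∧
      |u.im - (v.im + K.im / ‖K‖ ^ 2)| < ρ₀ / ‖K‖ ∧
      -2 * v.im * (K.im / ‖K‖ ^ 2) - (2 * |v.im| * (ρ₀ / ‖K‖) + (|K.im| / ‖K‖ ^ 2 + ρ₀ / ‖K‖) ^ 2) ≤ v.im ^ 2 - u.im ^ 2 := by
  obtain ⟨u, hu, hF0, hh0⟩ := door F h v K ρ₀ Λ hF hh hfac hK hρ hΛ hzf hlip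
  exact ⟨u, hF0, hh0, hu, im_window_of_newton_disc hu, energy_drop_of_newton_disc hu⟩

end RhW08.NewtonDiscDrop
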